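import Summits.AtomisticToContinuum.HydrodynamicLimit.Theorems.OneFlightGossipEngineEnergyCurrentTailsPedigreeObjects
import Summits.AtomisticToContinuum.HydrodynamicLimit.Theorems.OneFlightGossipEngineEnergyCurrentTailsPedigreeKinematics
import HarnessLib

/-!
# Level inclusion of the line `pedigree-perpetuity`
# (crux `EnergyCurrentTails`, stmt-AtomisticToContinuum-9235)

Sorry-free proof of the registered stub
`stub_levelInclusion : LineageLedgerSure → LevelInclusion` of the line `pedigree-perpetuity`
(lead seat c3, `prover-line-stmt-AtomisticToContinuum-9235-c3-0`; vocabulary file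
`…Theorems.OneFlightGossipEngineEnergyCurrentTailsPedigreeObjects`, tools
`…Theorems.OneFlightGossipEngineEnergyCurrentTailsPedigreeKinematics`).

## Content

* §1 (namespace `StubLevelInclusion`, abstract real sequences): discount weights
  `w n = Π_{j<n} sh j ∈ [0,1]`, `w n ≤ (1−δ)^{G n}` for a good-step counter `G`; the BACKWARD
  PERPETUITY WITH THERMAL ALLOWANCE `E 0 ≤ Θ₀ Σ_{j<n₀} w j + Λ + E n₀ · w n₀` (`n₀ ≤ K`, from
  `backward_perpetuity` with the quanta `q̃ n = E n − sh n · E (n+1) ≤ Θ₀ + lift n`); the discounted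
  count against the block allowances (`sum_pow_eq_sum_fiber`); the maximal admissible prefix; and
  the four-way case analysis `levelInclusion_of_perpetuity` ((R) long energetic block prefix /
  (Λ) large warm intake / (I) large discounted inheritance / (D) huge total energy).
* §2 (namespace `StubLevelInclusion`, vocabulary facts): `goodCount` is a unit-step counter,
  `Genuine n ↔ n < termIndex` under downward closure + termination, and the discounted warm intake
  `warmIntake` is then the finite sum of the discounted lifts over `n < termIndex`.
* §3 the registered theorem `stub_levelInclusion`, by instantiating §1 with the lineage quantities
  of `(i, s)` on the trajectory `r ↦ Φ.flow r z` supplied by `LineageLedgerSure`.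

No new definitions, no named facts; elementary real analysis over Mathlib's `Finset` / `tsum` /
`Set.encard` API.
-/

noncomputable section

open MeasureTheory Set Filter
open scoped ENNReal InnerProductSpace BigOperators

namespace Summit.AtomisticToContinuum.HydrodynamicLimit.Theorems.EnergyCurrentTailsPedigree

open Literature.MathematicalPhysics.KineticTheory Literature.Analysis.FluidPDE

namespace StubLevelInclusion

/-! ## §1 Abstract perpetuity cases (real sequences) -/

section PerpetuityCases

variable {E sh projE lift w : ℕ → ℝ} {G : ℕ → ℕ} {δ Θ₀ Λ : ℝ} {K : ℕ}

/-- Discount weights `w n = Π_{j<n} sh j` of shares in `[0,1]` lie in `[0,1]`. -/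
theorem prod_range_mem_unitInterval (hK0 : ∀ n, 0 ≤ sh n ∧ sh n ≤ 1)
    (hw : ∀ n, w n = ∏ j ∈ Finset.range n, sh j) (n : ℕ) : 0 ≤ w n ∧ w n ≤ 1 := by
  rw [hw n]
  exact ⟨Finset.prod_nonneg fun j _ => (hK0 j).1,
    Finset.prod_le_one (fun j _ => (hK0 j).1) fun j _ => (hK0 j).2⟩

/-- Discount weights against an abstract good-step counter `G` (`G 0 = 0`, `G` steps by one exactly
at the good steps `sh n ≤ 1 − δ`): `w n ≤ (1−δ)^{G n}`. -/
theorem prod_range_le_pow_count (hK0 : ∀ n, 0 ≤ sh n ∧ sh n ≤ 1)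
    (hw : ∀ n, w n = ∏ j ∈ Finset.range n, sh j) (hδ1 : δ ≤ 1) (hG0 : G 0 = 0)
    (hGs : ∀ n, sh n ≤ 1 - δ → G (n + 1) = G n + 1)
    (hGn : ∀ n, ¬ sh n ≤ 1 - δ → G (n + 1) = G n) (n : ℕ) : w n ≤ (1 - δ) ^ G n := by
  induction n with
  | zero => simp [hw, hG0]
  | succ n ih =>
    have hp : 0 ≤ (1 - δ) ^ G n := pow_nonneg (by linarith) _
    have hstep : w (n + 1) = w n * sh n := by rw [hw, hw, Finset.prod_range_succ]
    rw [hstep]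
    by_cases hg : sh n ≤ 1 - δ
    · rw [hGs n hg, pow_succ]
      exact mul_le_mul ih hg (hK0 n).1 hp
    · rw [hGn n hg]
      calc w n * sh n ≤ (1 - δ) ^ G n * 1 := mul_le_mul ih (hK0 n).2 (hK0 n).1 hp
        _ = _ := mul_one _

/-- Fibre counts of `G` over `range (n+1)` versus `range n`. -/
theorem card_filter_range_add_one (G : ℕ → ℕ) (g n : ℕ) :
    ((Finset.range (n + 1)).filter fun j => G j = g).card
      = ((Finset.range n).filter fun j => G j = g).card + if G n = g then 1 else 0 := by
  rw [Finset.range_add_one, Finset.filter_insert]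
  split_ifs with h
  · rw [Finset.card_insert_of_notMem (by simp)]
  · rfl

/-- **Perpetuity with thermal allowance.**  From the identification `E (n+1) = projE n` (`n < K`),
lifts `E n − sh n · projE n − Θ₀ ≤ lift n`, `0 ≤ lift n` and `Σ_{n<K} lift n · w n ≤ Λ`:
for every `n₀ ≤ K`, `E 0 ≤ Θ₀ Σ_{j<n₀} w j + Λ + E n₀ · w n₀` (backward perpetuity with the
quanta `q̃ n := E n − sh n · E (n+1)`). -/
theorem perpetuity_allowance (hK0 : ∀ n, 0 ≤ sh n ∧ sh n ≤ 1)
    (hid : ∀ n, n < K → E (n + 1) = projE n) (hw : ∀ n, w n = ∏ j ∈ Finset.range n, sh j)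
    (hlift : ∀ n, n < K → E n - sh n * projE n - Θ₀ ≤ lift n) (hlift0 : ∀ n, n < K → 0 ≤ lift n)
    (hΛ : ∑ n ∈ Finset.range K, lift n * w n ≤ Λ) (n₀ : ℕ) (hn₀ : n₀ ≤ K) :
    E 0 ≤ Θ₀ * ∑ j ∈ Finset.range n₀, w j + Λ + E n₀ * w n₀ := by
  have hw0 : ∀ n, 0 ≤ w n := fun n => (prod_range_mem_unitInterval hK0 hw n).1
  have hper := backward_perpetuity E sh (fun n => E n - sh n * E (n + 1)) (fun n => (hK0 n).1) n₀
    (fun n _ => by linarith)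
  simp only [← hw] at hper
  have hsum : ∑ n ∈ Finset.range n₀, (E n - sh n * E (n + 1)) * w n
      ≤ ∑ n ∈ Finset.range n₀, (Θ₀ * w n + lift n * w n) := by
    refine Finset.sum_le_sum fun n hn => ?_
    have hnK : n < K := lt_of_lt_of_le (Finset.mem_range.1 hn) hn₀
    rw [hid n hnK, ← add_mul]
    exact mul_le_mul_of_nonneg_right (by linarith [hlift n hnK]) (hw0 n)
  have hsum2 : ∑ n ∈ Finset.range n₀, lift n * w n ≤ ∑ n ∈ Finset.range K, lift n * w n :=
    Finset.sum_le_sum_of_subset_of_nonneg (Finset.range_mono hn₀)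
      fun n hn _ => mul_nonneg (hlift0 n (Finset.mem_range.1 hn)) (hw0 n)
  rw [Finset.sum_add_distrib, ← Finset.mul_sum] at hsum
  linarith

/-- **Discounted count against the allowances.**  If all `j < n₀` have `G j < g₁` and every fibre
`{j < n₀ | G j = g}` (`g < g₁`) has at most `m + g + 2` members, then
`Θ₀ Σ_{j<n₀} w j ≤ Θ₀ Σ_{g<g₁} (1−δ)^g (m+g+2)`. -/
theorem discounted_count_le_allowance (hK0 : ∀ n, 0 ≤ sh n ∧ sh n ≤ 1)
    (hw : ∀ n, w n = ∏ j ∈ Finset.range n, sh j) (hδ1 : δ ≤ 1) (hG0 : G 0 = 0)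
    (hGs : ∀ n, sh n ≤ 1 - δ → G (n + 1) = G n + 1)
    (hGn : ∀ n, ¬ sh n ≤ 1 - δ → G (n + 1) = G n) (hΘ₀ : 0 ≤ Θ₀) (m g₁ n₀ : ℕ)
    (hlt : ∀ j, j < n₀ → G j < g₁)
    (hok : ∀ g, g < g₁ → ((Finset.range n₀).filter fun j => G j = g).card ≤ m + g + 2) :
    Θ₀ * ∑ j ∈ Finset.range n₀, w j
      ≤ Θ₀ * ∑ g ∈ Finset.range g₁, (1 - δ) ^ g * ((m + g + 2 : ℕ) : ℝ) := by
  refine mul_le_mul_of_nonneg_left ?_ hΘ₀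
  calc ∑ j ∈ Finset.range n₀, w j ≤ ∑ j ∈ Finset.range n₀, (1 - δ) ^ G j :=
        Finset.sum_le_sum fun j _ => prod_range_le_pow_count hK0 hw hδ1 hG0 hGs hGn j
    _ = ∑ g ∈ Finset.range g₁, (1 - δ) ^ g
          * (((Finset.range n₀).filter fun n => G n = g).card : ℝ) :=
        sum_pow_eq_sum_fiber δ G n₀ g₁ hlt
    _ ≤ _ := Finset.sum_le_sum fun g hg => mul_le_mul_of_nonneg_left
        (by exact_mod_cast hok g (Finset.mem_range.1 hg)) (pow_nonneg (by linarith) _)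

/-- **The maximal admissible prefix.**  There is `n₁ ≤ K` such that all `j < n₁` have `G j < g₁`,
all fibres below `n₁` respect the allowances `m + g + 2`, and this fails for `n₁ + 1`. -/
theorem exists_maximal_prefix (G : ℕ → ℕ) (K m g₁ : ℕ) :
    ∃ n₁, n₁ ≤ K ∧ (∀ j, j < n₁ → G j < g₁)
      ∧ (∀ g, g < g₁ → ((Finset.range n₁).filter fun j => G j = g).card ≤ m + g + 2)
      ∧ ¬ (n₁ + 1 ≤ K ∧ (∀ j, j < n₁ + 1 → G j < g₁)
          ∧ (∀ g, g < g₁ → ((Finset.range (n₁ + 1)).filter fun j => G j = g).card ≤ m + g + 2)) := by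
  classical
  let P : ℕ → Prop := fun n => n ≤ K ∧ (∀ j, j < n → G j < g₁)
    ∧ (∀ g, g < g₁ → ((Finset.range n).filter fun j => G j = g).card ≤ m + g + 2)
  have hP0 : P 0 := ⟨Nat.zero_le _, fun j hj => absurd hj (Nat.not_lt_zero _), fun g _ => by simp⟩
  have hex : ∃ n, ¬ P (n + 1) := ⟨K, fun h => absurd h.1 (by omega)⟩
  refine ⟨Nat.find hex, ?_⟩
  have hspec : ¬ P (Nat.find hex + 1) := Nat.find_spec hex
  have hle : P (Nat.find hex) := by
    rcases (Nat.find hex).eq_zero_or_pos with h | h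
    · rw [h]; exact hP0
    · have := Nat.find_min hex (m := Nat.find hex - 1) (by omega)
      rw [not_not] at this
      have h' : Nat.find hex - 1 + 1 = Nat.find hex := by omega
      rwa [h'] at this
  exact ⟨hle.1, hle.2.1, hle.2.2, hspec⟩

end PerpetuityCases

/-- **Level inclusion from the perpetuity (abstract real-sequence form).**  Sequences: carried
energies `E ≥ 0`, shares `sh ∈ [0,1]`, projectile pre-energies `projE` with `E (n+1) = projE n`
below the terminal index `K`, lifts with `E n − sh n·projE n − Θ₀ ≤ lift n` and `0 ≤ lift n`
(`n < K`), weights `w n = Π_{j<n} sh j`, discounted intake bound `Σ_{n<K} lift n · w n ≤ Λ`, a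
good-step counter `G` (`G 0 = 0`, unit steps exactly at `sh n ≤ 1−δ`), blocks
`B g = {n < K | G n = g}` and an energy cap `E n ≤ Etot`.  If `Θ₀ Σ_{g<g₁} (1−δ)^g (m+g+2) ≤ LΘ₀/3`,
`3Θe ≤ LΘ₀` and `LΘ₀ ≤ E 0`, then: (R) some block `g < g₁` has an energetic prefix (`Θe ≤ projE`)
with at least `m+g+2` members, or (Λ) `LΘ₀/3 ≤ Λ`, or (I) `LΘ₀/3 ≤ E K · w K`, or (D)
`LΘ₀/3 ≤ (1−δ)^{g₁} Etot`.  Proof: backward perpetuity at the maximal admissible prefix `n₁`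
(`E n₁ w n₁ > LΘ₀/3` unless (Λ)); the prefix stops because `n₁ = K` (I), or `G n₁ ≥ g₁` (D), or a
fibre `g < g₁` below `n₁` is full, and then its `m+g+2` members are energetic by the perpetuity at
each of them (R). -/
theorem levelInclusion_of_perpetuity :
    ∀ (E sh projE lift w : ℕ → ℝ) (G : ℕ → ℕ) (B : ℕ → Set ℕ) (K m g₁ : ℕ)
      (δ Θ₀ Θe L Λ Etot : ℝ),
    (∀ n, 0 ≤ sh n ∧ sh n ≤ 1) → (∀ n, 0 ≤ E n) → (∀ n, n < K → E (n + 1) = projE n) →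
    (∀ n, w n = ∏ j ∈ Finset.range n, sh j) →
    (∀ n, n < K → E n - sh n * projE n - Θ₀ ≤ lift n) → (∀ n, n < K → 0 ≤ lift n) →
    (∑ n ∈ Finset.range K, lift n * w n ≤ Λ) →
    G 0 = 0 → (∀ n, sh n ≤ 1 - δ → G (n + 1) = G n + 1) →
    (∀ n, ¬ sh n ≤ 1 - δ → G (n + 1) = G n) →
    (∀ g n, n ∈ B g ↔ n < K ∧ G n = g) → (∀ n, E n ≤ Etot) →
    0 ≤ δ → δ < 1 → 0 ≤ Θ₀ →
    Θ₀ * (∑ g ∈ Finset.range g₁, (1 - δ) ^ g * ((m + g + 2 : ℕ) : ℝ)) ≤ L * Θ₀ / 3 →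
    3 * Θe ≤ L * Θ₀ → L * Θ₀ ≤ E 0 →
      (∃ g, g < g₁ ∧ ((m + g + 2 : ℕ) : ℕ∞)
          ≤ Set.encard {n | n ∈ B g ∧ ∀ n', n' ∈ B g → n' ≤ n → Θe ≤ projE n'})
      ∨ L * Θ₀ / 3 ≤ Λ
      ∨ L * Θ₀ / 3 ≤ E K * w K
      ∨ L * Θ₀ / 3 ≤ (1 - δ) ^ g₁ * Etot := by
  intro E sh projE lift w G B K m g₁ δ Θ₀ Θe L Λ Etot hK0 hE0 hid hw hlift hlift0 hΛ hG0 hGs hGn hB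
    hcap hδ0 hδ1 hΘ₀ h1 h2 hlev
  by_cases hΛ' : L * Θ₀ / 3 ≤ Λ
  · exact Or.inr (Or.inl hΛ')
  push Not at hΛ'
  have hw01 := prod_range_mem_unitInterval hK0 hw
  have claimB : ∀ n₀, n₀ ≤ K → (∀ j, j < n₀ → G j < g₁) →
      (∀ g, g < g₁ → ((Finset.range n₀).filter fun j => G j = g).card ≤ m + g + 2) →
      L * Θ₀ / 3 < E n₀ * w n₀ := by
    intro n₀ hn₀ hlt hok
    have hP := perpetuity_allowance hK0 hid hw hlift hlift0 hΛ n₀ hn₀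
    have hA := discounted_count_le_allowance hK0 hw hδ1.le hG0 hGs hGn hΘ₀ m g₁ n₀ hlt hok
    linarith
  obtain ⟨n₁, hn₁K, hn₁lt, hn₁ok, hstop⟩ := exists_maximal_prefix G K m g₁
  have hB1 := claimB n₁ hn₁K hn₁lt hn₁ok
  by_cases hKeq : n₁ = K
  · -- (I): the admissible prefix reaches the terminal index
    subst hKeq
    exact Or.inr (Or.inr (Or.inl hB1.le))
  have hn₁K' : n₁ + 1 ≤ K := by omega
  by_cases hG1 : g₁ ≤ G n₁
  · -- (D): `g₁` good steps before `n₁`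
    refine Or.inr (Or.inr (Or.inr ?_))
    have hwle : w n₁ ≤ (1 - δ) ^ g₁ :=
      (prod_range_le_pow_count hK0 hw hδ1.le hG0 hGs hGn n₁).trans
        (pow_le_pow_of_le_one (by linarith) (by linarith) hG1)
    have hmul : E n₁ * w n₁ ≤ (1 - δ) ^ g₁ * Etot :=
      calc E n₁ * w n₁ ≤ E n₁ * (1 - δ) ^ g₁ := mul_le_mul_of_nonneg_left hwle (hE0 n₁)
        _ ≤ Etot * (1 - δ) ^ g₁ :=
          mul_le_mul_of_nonneg_right (hcap n₁) (pow_nonneg (by linarith) _)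
        _ = (1 - δ) ^ g₁ * Etot := mul_comm _ _
    linarith
  push Not at hG1
  have hlt' : ∀ j, j < n₁ + 1 → G j < g₁ := fun j hj => by
    rcases Nat.lt_succ_iff_lt_or_eq.1 hj with h | rfl
    · exact hn₁lt j h
    · exact hG1
  have hnot : ¬ ∀ g, g < g₁ →
      ((Finset.range (n₁ + 1)).filter fun j => G j = g).card ≤ m + g + 2 :=
    fun h => hstop ⟨hn₁K', hlt', h⟩
  push Not at hnot
  obtain ⟨g, hg, hcg⟩ := hnot
  rw [card_filter_range_add_one] at hcg
  have hGg : G n₁ = g := by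
    by_contra hne
    rw [if_neg hne] at hcg
    have := hn₁ok g hg
    omega
  rw [if_pos hGg] at hcg
  have hcount : m + g + 2 ≤ ((Finset.range n₁).filter fun j => G j = g).card := by
    have := hn₁ok g hg
    omega
  -- (R): the first `m + g + 2` members of block `g` are energetic
  refine Or.inl ⟨g, hg, ?_⟩
  have henerg : ∀ j, j < n₁ → Θe ≤ projE j := by
    intro j hj
    have hBj := claimB (j + 1) (by omega) (fun j' hj' => hn₁lt j' (by omega))
      (fun g' hg' => le_trans (Finset.card_le_card
        (Finset.filter_subset_filter _ (Finset.range_mono (by omega)))) (hn₁ok g' hg'))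
    have hjK : j < K := by omega
    rw [← hid j hjK]
    have hEw : E (j + 1) * w (j + 1) ≤ E (j + 1) := by
      have := mul_le_mul_of_nonneg_left (hw01 (j + 1)).2 (hE0 (j + 1))
      simpa using this
    linarith
  calc ((m + g + 2 : ℕ) : ℕ∞) ≤ (((Finset.range n₁).filter fun j => G j = g).card : ℕ∞) := by
        exact_mod_cast hcount
    _ = Set.encard (((Finset.range n₁).filter fun j => G j = g : Finset ℕ) : Set ℕ) :=
        (Set.encard_coe_eq_coe_finsetCard _).symm
    _ ≤ _ := Set.encard_le_encard ?_
  intro j hj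
  rw [Finset.mem_coe, Finset.mem_filter, Finset.mem_range] at hj
  refine ⟨(hB g j).2 ⟨by omega, hj.2⟩, fun n' hn' hn'j => henerg n' ?_⟩
  have := ((hB g n').1 hn').1
  omega

/-! ## §2 Facts about the vocabulary -/

section Facts

variable {N : ℕ} (ε : ℝ) (γ : ℝ → Config N (Fin 3) T3) (i : Fin N) (s : ℝ)

/-- The good-step counter starts at `0`. -/
theorem goodCount_zero (δ : ℝ) : goodCount ε γ δ i s 0 = 0 := by
  simp [goodCount]

/-- The good-step counter steps by one at a good (δ-splitting) transition. -/
theorem goodCount_succ_of_good (δ : ℝ) (n : ℕ) (h : share ε γ i s n ≤ 1 - δ) :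
    goodCount ε γ δ i s (n + 1) = goodCount ε γ δ i s n + 1 := by
  classical
  unfold goodCount
  rw [Finset.range_add_one, Finset.filter_insert, if_pos (show Good ε γ δ i s n from h),
    Finset.card_insert_of_notMem (by simp)]

/-- The good-step counter is unchanged at a δ-neutral transition. -/
theorem goodCount_succ_of_not_good (δ : ℝ) (n : ℕ) (h : ¬ share ε γ i s n ≤ 1 - δ) :
    goodCount ε γ δ i s (n + 1) = goodCount ε γ δ i s n := by
  classical
  unfold goodCount
  rw [Finset.range_add_one, Finset.filter_insert, if_neg (show ¬ Good ε γ δ i s n from h)]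

/-- Downward closure of genuineness, iterated. -/
theorem genuine_of_genuine_add (hdown : ∀ n, Genuine ε γ i s (n + 1) → Genuine ε γ i s n)
    (k : ℕ) : ∀ d, Genuine ε γ i s (k + d) → Genuine ε γ i s k
  | 0, h => h
  | d + 1, h => genuine_of_genuine_add hdown k d (hdown _ h)

/-- On a lineage whose genuineness is downward closed and eventually fails,
`Genuine n ↔ n < K*` (`K* = termIndex`, the first non-genuine transition). -/
theorem genuine_iff_lt_termIndex (hdown : ∀ n, Genuine ε γ i s (n + 1) → Genuine ε γ i s n)
    (hterm : ∃ K, ¬ Genuine ε γ i s K) (n : ℕ) :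
    Genuine ε γ i s n ↔ n < termIndex ε γ i s := by
  have hmem : termIndex ε γ i s ∈ {n | ¬ Genuine ε γ i s n} := Nat.sInf_mem hterm
  constructor
  · intro hn
    by_contra hge
    push Not at hge
    obtain ⟨d, hd⟩ := Nat.exists_eq_add_of_le hge
    rw [hd] at hn
    exact hmem (genuine_of_genuine_add ε γ i s hdown _ d hn)
  · intro hn
    by_contra h
    exact Nat.notMem_of_lt_sInf hn h

/-- With `Genuine n ↔ n < K*`, the discounted warm intake is the finite sum over `n < K*`. -/
theorem warmIntake_eq_sum (Θ₀ : ℝ) (hiff : ∀ n, Genuine ε γ i s n ↔ n < termIndex ε γ i s) :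
    warmIntake ε γ Θ₀ i s
      = ∑ n ∈ Finset.range (termIndex ε γ i s), lift ε γ Θ₀ i s n * weight ε γ i s n := by
  unfold warmIntake
  rw [tsum_eq_sum (s := Finset.range (termIndex ε γ i s))
    (fun n hn => if_neg (by rwa [hiff, ← Finset.mem_range]))]
  exact Finset.sum_congr rfl fun n hn => if_pos ((hiff n).2 (Finset.mem_range.1 hn))

end Facts

end StubLevelInclusion

/-! ## §3 The registered stub -/

open StubLevelInclusion in
/-- **Stub 3 of the line `pedigree-perpetuity` — LEVEL INCLUSION** (registered signature): the sure
ledger implies the deterministic level inclusion.  Instantiate `levelInclusion_of_perpetuity` with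
the lineage quantities of `(i, s)` on the trajectory `r ↦ Φ.flow r z`: `K = termIndex`,
`Genuine n ↔ n < K` (downward closure + termination), `Λ = warmIntake` is the finite sum of the
discounted lifts over `n < K`, `E_K = ‖(z seed).2‖²`, `E_0 = ‖v_i(s)‖²` (no collision at `s`). -/
theorem stub_levelInclusion : LineageLedgerSure → LevelInclusion := by
  intro hL σ N Φ z hz i s hs hpart δ Θ₀ Θe L m g₁ hδ0 hδ1 hΘ₀ h1 h2 hlev
  obtain ⟨hK0, hK, -, hdown, hterm, hEK, hE0, hcap⟩ := (hL σ N Φ).1 z hz i s hs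
  have hiff := genuine_iff_lt_termIndex (hsDiameter σ N) (fun r => Φ.flow r z) i s hdown hterm
  have hres := levelInclusion_of_perpetuity
    (energy (hsDiameter σ N) (fun r => Φ.flow r z) i s)
    (share (hsDiameter σ N) (fun r => Φ.flow r z) i s)
    (projEnergy (hsDiameter σ N) (fun r => Φ.flow r z) i s)
    (lift (hsDiameter σ N) (fun r => Φ.flow r z) Θ₀ i s)
    (weight (hsDiameter σ N) (fun r => Φ.flow r z) i s)
    (goodCount (hsDiameter σ N) (fun r => Φ.flow r z) δ i s)
    (block (hsDiameter σ N) (fun r => Φ.flow r z) δ i s)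
    (termIndex (hsDiameter σ N) (fun r => Φ.flow r z) i s) m g₁ δ Θ₀ Θe L
    (warmIntake (hsDiameter σ N) (fun r => Φ.flow r z) Θ₀ i s)
    (∑ l : Fin (N + 1), ‖(z l).2‖ ^ 2)
    hK0 (fun n => by unfold energy; positivity)
    (fun n hn => (hK n ((hiff n).2 hn)).2.2.1)
    (fun n => rfl)
    (fun n _ => by unfold lift; exact le_max_left _ _)
    (fun n _ => by unfold lift; exact le_max_right _ _)
    (le_of_eq (warmIntake_eq_sum (hsDiameter σ N) (fun r => Φ.flow r z) i s Θ₀ hiff).symm)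
    (goodCount_zero (hsDiameter σ N) (fun r => Φ.flow r z) i s δ)
    (fun n hn => goodCount_succ_of_good (hsDiameter σ N) (fun r => Φ.flow r z) i s δ n hn)
    (fun n hn => goodCount_succ_of_not_good (hsDiameter σ N) (fun r => Φ.flow r z) i s δ n hn)
    (fun g n => ⟨fun h => ⟨(hiff n).1 h.1, h.2⟩, fun h => ⟨(hiff n).2 h.1, h.2⟩⟩)
    hcap hδ0.le hδ1 hΘ₀.le h1 h2 (by rw [hE0 hpart]; exact hlev)
  rcases hres with hR | hΛ | hI | hD
  · exact Or.inl hR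
  · exact Or.inr (Or.inl hΛ)
  · refine Or.inr (Or.inr (Or.inl ?_))
    rw [← hEK]
    exact hI
  · exact Or.inr (Or.inr (Or.inr hD))

end Summit.AtomisticToContinuum.HydrodynamicLimit.Theorems.EnergyCurrentTailsPedigree

end
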